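import Literature.MathematicalPhysics.QuantumFieldTheory.LatticeRPMechanism
import HarnessLib

/-!
# Lattice reflection positivity with a shared block of coordinates (site reflections)

Theorem-only companion to `Literature.MathematicalPhysics.QuantumFieldTheory.LatticeRPMechanism`
(namespace `Literature.MathematicalPhysics.QuantumFieldTheory.LatticeRP`; same objects:
the product probability measure `μ = piMeasure μ₀` on `Ω = ι → G`, the coordinate splice
`splice C (U, Y)`). The core positivity lemma of that file,
`LatticeRP.integral_splice_mul_conj_comp`, treats reflections in hyperplanes lying BETWEEN lattice
planes: the observable `Φ` depends on the positive coordinates `P` and the crossing coordinates `C`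
(which are randomised by the splice), and no coordinate is shared between `Φ` and its reflection.
For reflections in LATTICE planes (and for the mixed situation forced by an odd period — one
lattice plane, one plane between lattice planes) the observable also depends on a block `M` of
coordinates lying IN the reflection plane, which the reflection fixes. This file proves the
corresponding generalisation, by conditioning on the shared block:

* `integral_splice_mul_conj_comp_of_shared` — let `Θ` preserve `μ`, fix the `M`-coordinates, and
  let the `P ∪ C`-coordinates of `Θ U` depend only on `U` off `P`, where `M` is disjoint from `P`
  and from `C`. Then for every bounded measurable `Φ` depending only on the coordinates in
  `P ∪ C ∪ M`,
  `∫∫ Φ(splice C (U, Y)) conj Φ(Θ U) dμ(U) dμ(Y) = ∫ χ conj χ dμ`, where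
  `χ(V) = ∫ Φ(splice (P ∪ C) (V, W)) dμ(W)` is the average of `Φ` over the `P ∪ C`-coordinates
  (a function of the `M`-coordinates); in particular it is `≥ 0`
  (`integral_splice_mul_conj_comp_of_shared_nonneg`). For `M = ∅` this is the lemma of the
  parent file (`χ` is then the constant `∫ Φ`).
* `integral_mul_conj_mul_exp_nonneg_of_shared` — the same combined with the Gram expansion of
  the parent file (`LatticeRP.integral_mul_mul_exp_sum_nonneg`): abstract reflection positivity
  `0 ≤ ∫∫ g(z) conj g(ΘU) exp(∑ᵢ aᵢ(z) conj aᵢ(ΘU))`, `z = splice C (U, Y)`, for bounded measurable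
  `g, aᵢ` depending only on `P ∪ C ∪ M`.

Proof of the identity (all within `Ω`, by the splice trick of the parent file): writing
`U = splice P (V, W)` with `V, W` independent, the reflected factor depends on `V` only and the
`W`-integral of the positive factor is a function `ψ_Y` of the `M`-coordinates of `V`; by
`Θ`-invariance of `μ` and `Θ ∣_M = id`, `∫ conj Φ(ΘV) ψ_Y(V) = ∫ conj Φ(V) ψ_Y(V)`; splitting
`V = splice (P ∪ C) (V', W')` gives `∫ ψ_Y(V') conj χ(V')`; finally
`splice C (splice P (V', W), Y) = splice (P ∪ C) (V', splice C (W, Y))`, so that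
`∫ ψ_Y(V') dμ(Y) = χ(V')`. This is the measure-theoretic content of reflection positivity for
reflections in lattice hyperplanes (Fröhlich–Israel–Lieb–Simon, Comm. Math. Phys. 62 (1978) 1,
Thm. 2.1 ("`θ`-reflection through sites"); Osterwalder–Seiler, Ann. Phys. 110 (1978) 440, §2),
used by `Literature.Barriers.QuantumFields.FiniteTemperatureDeconfinement` (positivity of the
Polyakov-loop charge sectors in the time direction, Borgs–Seiler 1983 (III.25)). All statements
here are proved. [folklore]
-/

open MeasureTheory ProbabilityTheory Finset Filter
open scoped ComplexOrder ENNReal NNReal ComplexConjugate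

namespace Literature.MathematicalPhysics.QuantumFieldTheory.LatticeRP

noncomputable section

variable {ι : Type*} [Fintype ι] [DecidableEq ι] {G : Type*} [MeasurableSpace G]
variable (μ₀ : Measure G) [IsProbabilityMeasure μ₀]

/-! ## Splice bookkeeping -/

omit [Fintype ι] [MeasurableSpace G] in
/-- Splicing twice: `C`-coordinates from `Y`, then `P`-coordinates from `W`, is splicing the
`P ∪ C`-coordinates from `splice C (W, Y)`. [folklore] -/
theorem splice_splice_eq_splice_union (P C : Finset ι) (V W Y : ι → G) :
    splice C (splice P (V, W), Y) = splice (P ∪ C) (V, splice C (W, Y)) := by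
  funext i
  simp only [splice_apply, Finset.mem_union]
  by_cases hC : i ∈ C <;> by_cases hP : i ∈ P <;> simp [hC, hP]

omit [Fintype ι] [MeasurableSpace G] in
/-- A function depending only on coordinates in `S` does not see a splice of coordinates
outside `S`. [folklore] -/
theorem apply_splice_of_dependsOn_of_disjoint {β : Type*} {f : (ι → G) → β} {S T : Finset ι}
    (hf : DependsOn f (S : Set ι)) (hST : Disjoint S T) (V W : ι → G) :
    f (splice T (V, W)) = f V := by
  apply hf
  intro i hi
  have hiT : i ∉ T := Finset.disjoint_left.1 hST (Finset.mem_coe.1 hi)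
  simp [splice_apply, hiT]

omit [MeasurableSpace G] in
/-- A function depending only on coordinates off `T` does not see a splice of the
`T`-coordinates. [folklore] -/
theorem apply_splice_of_dependsOn_compl {β : Type*} {f : (ι → G) → β} {T : Finset ι}
    (hf : DependsOn f ((Tᶜ : Finset ι) : Set ι)) (V W : ι → G) :
    f (splice T (V, W)) = f V := by
  apply hf
  intro i hi
  have hiT : i ∉ T := by simpa using Finset.mem_coe.1 hi
  simp [splice_apply, hiT]

omit [Fintype ι] [MeasurableSpace G] in
/-- If `Φ` depends only on `P ∪ C ∪ M`, then for fixed `Y` the function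
`U ↦ Φ (splice C (U, Y))` depends only on the `P ∪ M`-coordinates of `U`. [folklore] -/
theorem dependsOn_splice_left_of_shared {β : Type*} (P C M : Finset ι) {Φ : (ι → G) → β}
    (hΦ : DependsOn Φ ((P ∪ C ∪ M : Finset ι) : Set ι)) (Y : ι → G) :
    DependsOn (fun U => Φ (splice C (U, Y))) ((P ∪ M : Finset ι) : Set ι) := by
  intro U V hUV
  apply hΦ
  intro i hi
  simp only [splice_apply]
  split_ifs with hC
  · rfl
  · have hiPM : i ∈ P ∪ M := by
      rcases Finset.mem_union.1 (Finset.mem_coe.1 hi) with h | h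
      · rcases Finset.mem_union.1 h with h | h
        · exact Finset.mem_union.2 (Or.inl h)
        · exact absurd h hC
      · exact Finset.mem_union.2 (Or.inr h)
    exact hUV i (Finset.mem_coe.2 hiPM)

omit [MeasurableSpace G] in
/-- If `Θ` fixes the `M`-coordinates, `M ∩ P = ∅`, and the `P ∪ C`-coordinates of `Θ U` depend
only on `U` off `P`, then `Φ ∘ Θ` depends only on the coordinates off `P` whenever `Φ` depends
only on `P ∪ C ∪ M`. [folklore] -/
theorem dependsOn_comp_of_shared (P C M : Finset ι) (Θ : (ι → G) → (ι → G)) {β : Type*}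
    {Φ : (ι → G) → β} (hΦ : DependsOn Φ ((P ∪ C ∪ M : Finset ι) : Set ι))
    (hΘM : ∀ U, ∀ i ∈ M, Θ U i = U i)
    (hΘdep : ∀ e ∈ P ∪ C, DependsOn (fun U => Θ U e) ((Pᶜ : Finset ι) : Set ι))
    (hMP : Disjoint M P) :
    DependsOn (fun U => Φ (Θ U)) ((Pᶜ : Finset ι) : Set ι) := by
  intro U V hUV
  apply hΦ
  intro e he
  rcases Finset.mem_union.1 (Finset.mem_coe.1 he) with hePC | heM
  · exact hΘdep e hePC hUV
  · rw [hΘM U e heM, hΘM V e heM]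
    exact hUV e (Finset.mem_coe.2 (Finset.mem_compl.2 (Finset.disjoint_left.1 hMP heM)))

/-! ## Bounded measurable functions: integrability and parametric integrals -/

omit [Fintype ι] [DecidableEq ι] in
/-- A bounded measurable complex function on a finite measure space is integrable. [folklore] -/
theorem integrable_of_norm_le {X : Type*} [MeasurableSpace X] {ν : Measure X}
    [IsFiniteMeasure ν] {f : X → ℂ} (hf : Measurable f) {K : ℝ} (hK : ∀ x, ‖f x‖ ≤ K) :
    Integrable f ν :=
  Integrable.of_bound hf.aestronglyMeasurable K (ae_of_all _ hK)

omit [Fintype ι] [DecidableEq ι] in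
/-- The average of a function bounded by `K` over a probability measure is bounded by `K`. [folklore] -/
theorem norm_integral_le_of_norm_le_prob {X : Type*} [MeasurableSpace X] {ν : Measure X}
    [IsProbabilityMeasure ν] {f : X → ℂ} {K : ℝ} (hK : ∀ x, ‖f x‖ ≤ K) :
    ‖∫ x, f x ∂ν‖ ≤ K := by
  have h := norm_integral_le_of_norm_le_const (μ := ν) (f := f) (C := K) (ae_of_all _ hK)
  simpa using h

omit [Fintype ι] [DecidableEq ι] in
/-- A parametric integral of a jointly measurable complex function is measurable in the
parameter. [folklore] -/
theorem measurable_integral_parametric {X Y : Type*} [MeasurableSpace X] [MeasurableSpace Y]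
    {ν : Measure Y} [SFinite ν] {F : X × Y → ℂ} (hF : Measurable F) :
    Measurable fun x => ∫ y, F (x, y) ∂ν :=
  (hF.stronglyMeasurable.integral_prod_right').measurable

/-! ## The core positivity lemma with a shared block -/

variable (M P C : Finset ι) (Θ : (ι → G) → (ι → G))

/-- **Core positivity lemma of lattice reflection positivity, with a shared block.** Let `Θ`
preserve the product measure, fix the `M`-coordinates, and let the `P ∪ C`-coordinates of
`Θ U` depend only on `U` off `P`, with `M` disjoint from `P` and from `C`. Then for every bounded
measurable `Φ` depending only on the coordinates in `P ∪ C ∪ M`,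
`∫∫ Φ(splice C (U, Y)) conj Φ(Θ U) dμ(U) dμ(Y) = ∫ χ(V) conj χ(V) dμ(V)` with
`χ(V) = ∫ Φ(splice (P ∪ C) (V, W)) dμ(W)` (the average of `Φ` over its non-shared coordinates,
a function of the `M`-coordinates of `V`). [folklore] -/
theorem integral_splice_mul_conj_comp_of_shared
    (hΘ : MeasurePreserving Θ (piMeasure μ₀) (piMeasure μ₀))
    (hΘM : ∀ U, ∀ i ∈ M, Θ U i = U i)
    (hΘdep : ∀ e ∈ P ∪ C, DependsOn (fun U => Θ U e) ((Pᶜ : Finset ι) : Set ι))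
    (hMP : Disjoint M P) (hMC : Disjoint M C)
    {Φ : (ι → G) → ℂ} (hΦm : Measurable Φ) {K : ℝ} (hΦb : ∀ U, ‖Φ U‖ ≤ K)
    (hΦdep : DependsOn Φ ((P ∪ C ∪ M : Finset ι) : Set ι)) :
    ∫ p, Φ (splice C p) * conj (Φ (Θ p.1)) ∂((piMeasure μ₀).prod (piMeasure μ₀)) =
      ∫ V, (∫ W, Φ (splice (P ∪ C) (V, W)) ∂(piMeasure μ₀)) *
        conj (∫ W, Φ (splice (P ∪ C) (V, W)) ∂(piMeasure μ₀)) ∂(piMeasure μ₀) := by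
  set μ : Measure (ι → G) := piMeasure μ₀ with hμ
  have hΘm : Measurable Θ := hΘ.measurable
  have hconj : Measurable (starRingEnd ℂ : ℂ → ℂ) := Complex.continuous_conj.measurable
  -- the players
  set ψ : (ι → G) → (ι → G) → ℂ := fun Y V => ∫ W, Φ (splice C (splice P (V, W), Y)) ∂μ with hψ
  set χ : (ι → G) → ℂ := fun V => ∫ W, Φ (splice (P ∪ C) (V, W)) ∂μ with hχ
  -- measurability
  have hm3 : Measurable fun q : ((ι → G) × (ι → G)) × (ι → G) =>
      Φ (splice C (splice P (q.1.2, q.2), q.1.1)) :=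
    hΦm.comp ((measurable_splice C).comp
      (((measurable_splice P).comp ((measurable_snd.comp measurable_fst).prodMk measurable_snd)).prodMk
        (measurable_fst.comp measurable_fst)))
  have hψm2 : Measurable fun q : (ι → G) × (ι → G) => ψ q.1 q.2 :=
    measurable_integral_parametric hm3
  have hψm : ∀ Y, Measurable (ψ Y) := fun Y => hψm2.comp (measurable_const.prodMk measurable_id)
  have hχm : Measurable χ :=
    measurable_integral_parametric (hΦm.comp (measurable_splice (P ∪ C)))
  -- bounds
  have hψb : ∀ Y V, ‖ψ Y V‖ ≤ K := fun Y V => norm_integral_le_of_norm_le_prob fun W => hΦb _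
  have hχb : ∀ V, ‖χ V‖ ≤ K := fun V => norm_integral_le_of_norm_le_prob fun W => hΦb _
  -- dependence
  have hψdep : ∀ Y, DependsOn (ψ Y) ((M : Finset ι) : Set ι) := by
    intro Y V V' hVV'
    simp only [hψ]
    refine integral_congr_ae (ae_of_all _ fun W => ?_)
    apply dependsOn_splice_left_of_shared P C M hΦdep Y
    intro i hi
    simp only [splice_apply]
    split_ifs with hP
    · rfl
    · have hiM : i ∈ M := by
        rcases Finset.mem_union.1 (Finset.mem_coe.1 hi) with h | h
        · exact absurd h hP
        · exact h
      exact hVV' i (Finset.mem_coe.2 hiM)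
  have hχdep : DependsOn χ ((M : Finset ι) : Set ι) := by
    intro V V' hVV'
    simp only [hχ]
    refine integral_congr_ae (ae_of_all _ fun W => hΦdep fun i hi => ?_)
    simp only [splice_apply]
    split_ifs with hPC
    · rfl
    · have hiM : i ∈ M := by
        rcases Finset.mem_union.1 (Finset.mem_coe.1 hi) with h | h
        · exact absurd h hPC
        · exact h
      exact hVV' i (Finset.mem_coe.2 hiM)
  have hΦΘdep : DependsOn (fun U => conj (Φ (Θ U))) ((Pᶜ : Finset ι) : Set ι) := fun U V hUV =>
    congrArg conj (dependsOn_comp_of_shared P C M Θ hΦdep hΘM hΘdep hMP hUV)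
  -- Step A: for fixed `Y`, integrate out the `P`-coordinates of the positive factor
  have stepA : ∀ Y, ∫ U, Φ (splice C (U, Y)) * conj (Φ (Θ U)) ∂μ =
      ∫ V, conj (Φ (Θ V)) * ψ Y V ∂μ := by
    intro Y
    have hFm : Measurable fun U => Φ (splice C (U, Y)) * conj (Φ (Θ U)) :=
      (hΦm.comp ((measurable_splice C).comp (measurable_id.prodMk measurable_const))).mul
        (hconj.comp (hΦm.comp hΘm))
    -- `U = splice P (V, W)`
    rw [← integral_comp_eq_of_measurePreserving (measurePreserving_splice μ₀ P) hFm]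
    have hGi : Integrable (fun q : (ι → G) × (ι → G) =>
        Φ (splice C (splice P q, Y)) * conj (Φ (Θ (splice P q)))) (μ.prod μ) :=
      integrable_of_norm_le (hFm.comp (measurable_splice P)) (K := K * K) fun q => by
        rw [norm_mul, Complex.norm_conj]
        exact mul_le_mul (hΦb _) (hΦb _) (norm_nonneg _)
          ((norm_nonneg _).trans (hΦb (Θ (splice P q))))
    rw [integral_prod _ hGi]
    refine integral_congr_ae (ae_of_all _ fun V => ?_)
    have hΘV : ∀ W, conj (Φ (Θ (splice P (V, W)))) = conj (Φ (Θ V)) := fun W =>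
      apply_splice_of_dependsOn_compl hΦΘdep V W
    simp_rw [hΘV]
    rw [integral_mul_const, mul_comm]
  -- Step B: `Θ`-invariance moves the reflection onto the other factor
  have stepB : ∀ Y, ∫ V, conj (Φ (Θ V)) * ψ Y V ∂μ = ∫ V, conj (Φ V) * ψ Y V ∂μ := by
    intro Y
    have h1 : ∀ V, ψ Y V = ψ Y (Θ V) := fun V => hψdep Y fun i hi => (hΘM V i (Finset.mem_coe.1 hi)).symm
    calc ∫ V, conj (Φ (Θ V)) * ψ Y V ∂μ = ∫ V, conj (Φ (Θ V)) * ψ Y (Θ V) ∂μ := by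
          simp_rw [← h1]
      _ = ∫ V, conj (Φ V) * ψ Y V ∂μ :=
          integral_comp_eq_of_measurePreserving hΘ ((hconj.comp hΦm).mul (hψm Y))
  -- Step C: integrate out the `P ∪ C`-coordinates of the reflected factor
  have stepC : ∀ Y, ∫ V, conj (Φ V) * ψ Y V ∂μ = ∫ V, ψ Y V * conj (χ V) ∂μ := by
    intro Y
    have hFm : Measurable fun V => conj (Φ V) * ψ Y V := (hconj.comp hΦm).mul (hψm Y)
    rw [← integral_comp_eq_of_measurePreserving (measurePreserving_splice μ₀ (P ∪ C)) hFm]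
    have hGi : Integrable (fun q : (ι → G) × (ι → G) =>
        conj (Φ (splice (P ∪ C) q)) * ψ Y (splice (P ∪ C) q)) (μ.prod μ) :=
      integrable_of_norm_le (hFm.comp (measurable_splice (P ∪ C))) (K := K * K) fun q => by
        rw [norm_mul, Complex.norm_conj]
        exact mul_le_mul (hΦb _) (hψb _ _) (norm_nonneg _)
          ((norm_nonneg _).trans (hΦb (splice (P ∪ C) q)))
    rw [integral_prod _ hGi]
    refine integral_congr_ae (ae_of_all _ fun V => ?_)
    have hMPC : Disjoint M (P ∪ C) := Finset.disjoint_union_right.2 ⟨hMP, hMC⟩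
    have hψV : ∀ W, ψ Y (splice (P ∪ C) (V, W)) = ψ Y V := fun W =>
      apply_splice_of_dependsOn_of_disjoint (hψdep Y) hMPC V W
    simp only
    simp_rw [hψV]
    rw [integral_mul_const, ← integral_conj, mul_comm]
  -- Step D: the `Y`-average of `ψ Y` is `χ`
  have stepD : ∀ V, ∫ Y, ψ Y V ∂μ = χ V := by
    intro V
    simp only [hψ, hχ]
    simp_rw [splice_splice_eq_splice_union P C V]
    have hFm : Measurable fun Z => Φ (splice (P ∪ C) (V, Z)) :=
      hΦm.comp ((measurable_splice (P ∪ C)).comp (measurable_const.prodMk measurable_id))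
    have hGi : Integrable (fun q : (ι → G) × (ι → G) =>
        Φ (splice (P ∪ C) (V, splice C (q.2, q.1)))) (μ.prod μ) :=
      integrable_of_norm_le (hFm.comp ((measurable_splice C).comp measurable_swap)) fun q => hΦb _
    rw [← integral_prod _ hGi]
    have hswap : MeasurePreserving (fun q : (ι → G) × (ι → G) => splice C (q.2, q.1))
        (μ.prod μ) μ :=
      (measurePreserving_splice μ₀ C).comp (Measure.measurePreserving_swap (μ := μ) (ν := μ))
    exact integral_comp_eq_of_measurePreserving hswap hFm
  -- assemble: Fubini in `(U, Y)`, then in `(Y, V)`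
  have hJi : Integrable (fun p : (ι → G) × (ι → G) => Φ (splice C p) * conj (Φ (Θ p.1)))
      (μ.prod μ) :=
    integrable_of_norm_le ((hΦm.comp (measurable_splice C)).mul
      (hconj.comp (hΦm.comp (hΘm.comp measurable_fst)))) (K := K * K) fun p => by
        rw [norm_mul, Complex.norm_conj]
        exact mul_le_mul (hΦb _) (hΦb _) (norm_nonneg _) ((norm_nonneg _).trans (hΦb (Θ p.1)))
  rw [integral_prod_symm _ hJi]
  simp_rw [stepA, stepB, stepC]
  -- swap the `Y`- and `V`-integrals
  have hKi : Integrable (Function.uncurry fun Y V => ψ Y V * conj (χ V)) (μ.prod μ) :=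
    integrable_of_norm_le (hψm2.mul (hconj.comp (hχm.comp measurable_snd))) (K := K * K)
      fun q => by
        rw [Function.uncurry_apply_pair, norm_mul, Complex.norm_conj]
        exact mul_le_mul (hψb _ _) (hχb _) (norm_nonneg _) ((norm_nonneg _).trans (hψb q.1 q.2))
  rw [integral_integral_swap hKi]
  refine integral_congr_ae (ae_of_all _ fun V => ?_)
  dsimp only
  rw [integral_mul_const, stepD]

/-- The core lemma with a shared block as a positivity statement:
`0 ≤ ∫∫ Φ(splice C (U, Y)) conj Φ(Θ U)`. [folklore] -/
theorem integral_splice_mul_conj_comp_of_shared_nonneg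
    (hΘ : MeasurePreserving Θ (piMeasure μ₀) (piMeasure μ₀))
    (hΘM : ∀ U, ∀ i ∈ M, Θ U i = U i)
    (hΘdep : ∀ e ∈ P ∪ C, DependsOn (fun U => Θ U e) ((Pᶜ : Finset ι) : Set ι))
    (hMP : Disjoint M P) (hMC : Disjoint M C)
    {Φ : (ι → G) → ℂ} (hΦm : Measurable Φ) {K : ℝ} (hΦb : ∀ U, ‖Φ U‖ ≤ K)
    (hΦdep : DependsOn Φ ((P ∪ C ∪ M : Finset ι) : Set ι)) :
    0 ≤ ∫ p, Φ (splice C p) * conj (Φ (Θ p.1)) ∂((piMeasure μ₀).prod (piMeasure μ₀)) := by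
  rw [integral_splice_mul_conj_comp_of_shared μ₀ M P C Θ hΘ hΘM hΘdep hMP hMC hΦm hΦb hΦdep]
  have h : ∀ z : ℂ, z * conj z = ((‖z‖ ^ 2 : ℝ) : ℂ) := fun z => by
    rw [Complex.mul_conj, Complex.normSq_eq_norm_sq]
  simp_rw [h]
  rw [integral_complex_ofReal]
  exact Complex.zero_le_real.2 (integral_nonneg fun V => by positivity)

/-! ## The abstract reflection-positivity theorem with a shared block -/

/-- **Abstract lattice reflection positivity with a shared block.** Let `Θ` preserve the
product probability measure `μ` on `Ω = ι → G`, fix the `M`-coordinates, and let the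
`P ∪ C`-coordinates of `Θ U` depend only on `U` off `P`, where `M` is disjoint from `P` and `C`.
Let `g` and `aᵢ` (`i` in a finite set) be bounded measurable functions on `Ω` depending only
on the coordinates in `P ∪ C ∪ M`. Then
`∫∫ g(z) conj g(Θ U) exp(∑ᵢ aᵢ(z) conj aᵢ(Θ U)) dμ(U) dμ(Y) ≥ 0`, `z = splice C (U, Y)`
(Gram expansion of the exponential, `LatticeRP.integral_mul_mul_exp_sum_nonneg`, and the core
lemma with a shared block for each word). This is the form to which reflection positivity in a
lattice hyperplane (shared block = the link variables in the plane), or in the mixed situation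
of an odd period (one lattice plane and one plane between lattice planes, crossing links `C`),
reduces for nearest-neighbour (plaquette) couplings (Fröhlich–Israel–Lieb–Simon 1978, Thm. 2.1;
Osterwalder–Seiler 1978, §2). [folklore] -/
theorem integral_mul_conj_mul_exp_nonneg_of_shared
    (hΘ : MeasurePreserving Θ (piMeasure μ₀) (piMeasure μ₀))
    (hΘM : ∀ U, ∀ i ∈ M, Θ U i = U i)
    (hΘdep : ∀ e ∈ P ∪ C, DependsOn (fun U => Θ U e) ((Pᶜ : Finset ι) : Set ι))
    (hMP : Disjoint M P) (hMC : Disjoint M C)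
    {I : Type*} [Fintype I] {g : (ι → G) → ℂ} {a : I → (ι → G) → ℂ}
    (hgm : Measurable g) (ham : ∀ i, Measurable (a i)) {Kg Ka : ℝ} (hgb : ∀ U, ‖g U‖ ≤ Kg)
    (hab : ∀ i U, ‖a i U‖ ≤ Ka) (hgdep : DependsOn g ((P ∪ C ∪ M : Finset ι) : Set ι))
    (hadep : ∀ i, DependsOn (a i) ((P ∪ C ∪ M : Finset ι) : Set ι)) :
    0 ≤ ∫ p, g (splice C p) * conj (g (Θ p.1)) *
        Complex.exp (∑ i, a i (splice C p) * conj (a i (Θ p.1)))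
      ∂((piMeasure μ₀).prod (piMeasure μ₀)) := by
  have hΘm : Measurable Θ := hΘ.measurable
  have hconj : Measurable (starRingEnd ℂ : ℂ → ℂ) := Complex.continuous_conj.measurable
  refine integral_mul_mul_exp_sum_nonneg _ (fun p => g (splice C p))
    (fun p => conj (g (Θ p.1))) (fun i p => a i (splice C p))
    (fun i p => conj (a i (Θ p.1)))
    (hgm.comp (measurable_splice C)) (hconj.comp (hgm.comp (hΘm.comp measurable_fst)))
    (fun i => (ham i).comp (measurable_splice C))
    (fun i => hconj.comp ((ham i).comp (hΘm.comp measurable_fst)))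
    (Ku := Kg) (Ka := Ka) (fun p => hgb _) (fun p => by rw [Complex.norm_conj]; exact hgb _)
    (fun i p => hab i _) (fun i p => by rw [Complex.norm_conj]; exact hab i _) fun n w => ?_
  -- the word `w` gives the observable `Φ = g ∏ₜ a_{wₜ}`
  set Φ : (ι → G) → ℂ := fun U => g U * ∏ t, a (w t) U with hΦ_def
  have hΦm : Measurable Φ := hgm.mul (Finset.measurable_prod _ fun t _ => ham (w t))
  have hΦb : ∀ U, ‖Φ U‖ ≤ |Kg| * |Ka| ^ n := fun U => by
    rw [hΦ_def, norm_mul]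
    refine mul_le_mul ((hgb U).trans (le_abs_self _)) ?_ (norm_nonneg _) (abs_nonneg _)
    calc ‖∏ t, a (w t) U‖ = ∏ t, ‖a (w t) U‖ := norm_prod _ _
      _ ≤ ∏ _t : Fin n, |Ka| :=
          Finset.prod_le_prod (fun _ _ => norm_nonneg _) fun t _ => (hab _ _).trans (le_abs_self _)
      _ = |Ka| ^ n := by simp
  have hΦdep : DependsOn Φ ((P ∪ C ∪ M : Finset ι) : Set ι) := fun U V hUV => by
    simp only [hΦ_def]
    rw [hgdep hUV]
    congr 1
    exact Finset.prod_congr rfl fun t _ => hadep (w t) hUV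
  have key := integral_splice_mul_conj_comp_of_shared_nonneg μ₀ M P C Θ hΘ hΘM hΘdep hMP hMC
    hΦm hΦb hΦdep
  convert key using 2
  funext p
  simp only [hΦ_def, map_mul, map_prod]

end

end Literature.MathematicalPhysics.QuantumFieldTheory.LatticeRP
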